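import Summits.CriticalPhenomena.PercolationContinuityZ3.Theorems.SahiMasterFamilyFInequalityAMSLinearForm
import Summits.CriticalPhenomena.PercolationContinuityZ3.Theorems.SahiMasterFamilyFInequalityAMSCases
import Summits.CriticalPhenomena.PercolationContinuityZ3.Theorems.SahiMasterFamilyFInequalityMSLinear

/-!
# Conjecture (LA) holds under bottom witnesses (in particular whenever `∅ ∈ S`)

Support file for the master-family `F`-inequality programme (`prim-master-conj` gen 26; `--supports stmt-CriticalPhenomena-4575`;
memo `run/shared/lean/prim/prim-l12/prim-master-conj/POINTWISE.md` §27.4, `LA-CONJECTURE.md`).  No definition, no `sorry`, standard axioms.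

`TwistedAD.LARank` conjectures `#S ≤ 2 · rank_ℚ (laMatrix S R)`.  The pair lemma (`mem_amsUnions_or_compl_mem_of_witnesses`, `…AMSCases`) shows that
when every `u ∈ S` has same-type witnesses `m₁ ⊆ u`, `m₂ ⊆ uᶜ` in `S`, every antipodal pair of `S` meets `J(S,R)`; here this is upgraded from the
counting form of (AMS) to the RANK form (LA):

* `card_le_two_mul_rank_laMatrix_of_witnesses` — under the witness hypothesis, `#S ≤ 2 · rank (laMatrix S R)`;
* `card_le_two_mul_rank_laMatrix_of_empty_mem` — in particular whenever `∅ ∈ S` (e.g. the full cube with any labelling).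

Proof: let `Q = S ∩ J(S,R)`; the pair lemma gives `S ⊆ Q ∪ Qᶜˢ`, so `#S ≤ 2#Q`; the submatrix of `laMatrix S R = (𝟙[wᶜ ⊆ u])` on the rows `uᶜ`
(`u ∈ Q`) and the columns `u' ∈ Q` is the zeta matrix `(𝟙[u ⊆ u'])_{u,u' ∈ Q}`, which is invertible (`zeta_mulVec_injective`, `…MSLinear`), so
`rank ≥ #Q`. [this work]
-/

namespace Summit.CriticalPhenomena.PercolationContinuityZ3.Theorems

namespace TwistedAD

open Finset Matrix
open scoped FinsetFamily Classical

variable {κ : Type*} [Fintype κ] [DecidableEq κ]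

/-- **(LA) under bottom witnesses.**  If `R` is an equivalence relation with `¬R x xᶜ` on the complement-closed family `S` and every `u ∈ S` has
witnesses `m₁ ⊆ u`, `m₂ ⊆ uᶜ` in `S` with `R m₁ m₂` and `R m₁ᶜ m₂ᶜ`, then `#S ≤ 2 · rank_ℚ (laMatrix S R)`. [this work] -/
theorem card_le_two_mul_rank_laMatrix_of_witnesses (S : Finset (Finset κ)) (R : Finset κ → Finset κ → Prop) (hR : Equivalence R)
    (hScl : ∀ x ∈ S, xᶜ ∈ S) (hanti : ∀ x ∈ S, ¬ R x xᶜ)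
    (hwit : ∀ u ∈ S, ∃ m₁ ∈ S, ∃ m₂ ∈ S, m₁ ⊆ u ∧ m₂ ⊆ uᶜ ∧ R m₁ m₂ ∧ R m₁ᶜ m₂ᶜ) :
    S.card ≤ 2 * (laMatrix S R).rank := by
  set Q := S.filter (fun u => u ∈ amsUnions S R) with hQ
  -- every antipodal pair meets Q
  have hcov : S ⊆ Q ∪ Qᶜˢ := by
    intro u hu
    obtain ⟨m₁, hm₁, m₂, hm₂, h₁, h₂, ht, ht'⟩ := hwit u hu
    rcases mem_amsUnions_or_compl_mem_of_witnesses S R hR hScl hanti hu hm₁ hm₂ h₁ h₂ ht ht' with h | h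
    · exact mem_union.2 (Or.inl (mem_filter.2 ⟨hu, h⟩))
    · exact mem_union.2 (Or.inr (mem_compls.2 (mem_filter.2 ⟨hScl u hu, h⟩)))
  have hcardS : S.card ≤ 2 * Q.card := by
    calc S.card ≤ (Q ∪ Qᶜˢ).card := card_le_card hcov
      _ ≤ Q.card + Qᶜˢ.card := card_union_le _ _
      _ = 2 * Q.card := by rw [card_compls]; ring
  -- the submatrix on rows `uᶜ` (`u ∈ Q`) and columns `Q` is the (transposed) zeta matrix of `Q`
  let r : ↥Q → ↥S := fun u => ⟨(u : Finset κ)ᶜ, hScl _ (mem_filter.1 u.2).1⟩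
  let c : ↥Q → ↥(amsUnions S R) := fun u => ⟨(u : Finset κ), (mem_filter.1 u.2).2⟩
  have hsubm : (laMatrix S R).submatrix r c
      = (Matrix.of fun (x y : ↥Q) => if (y : Finset κ) ⊆ (x : Finset κ) then (1 : ℚ) else 0)ᵀ := by
    ext u u'
    simp only [laMatrix, Matrix.submatrix_apply, Matrix.of_apply, Matrix.transpose_apply, r, c, compl_compl]
  have hunit : IsUnit (Matrix.of fun (x y : ↥Q) => if (y : Finset κ) ⊆ (x : Finset κ) then (1 : ℚ) else 0) :=
    Matrix.mulVec_injective_iff_isUnit.1 (zeta_mulVec_injective Q)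
  have hrankQ : ((laMatrix S R).submatrix r c).rank = Q.card := by
    rw [hsubm, Matrix.rank_transpose, Matrix.rank_of_isUnit _ hunit, Fintype.card_coe]
  have hle : Q.card ≤ (laMatrix S R).rank := by
    rw [← hrankQ]; exact Matrix.rank_submatrix_le _ _ _
  omega

/-- **(LA) whenever `∅ ∈ S`** (witnesses `m₁ = m₂ = ∅`): for every equivalence relation `R` with `¬R x xᶜ` on the complement-closed family `S ∋ ∅`,
`#S ≤ 2 · rank_ℚ (laMatrix S R)`; e.g. the full cube `S = 2^[k]` with any labelling. [this work] -/
theorem card_le_two_mul_rank_laMatrix_of_empty_mem (S : Finset (Finset κ)) (R : Finset κ → Finset κ → Prop) (hR : Equivalence R)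
    (hScl : ∀ x ∈ S, xᶜ ∈ S) (hanti : ∀ x ∈ S, ¬ R x xᶜ) (h0 : (∅ : Finset κ) ∈ S) :
    S.card ≤ 2 * (laMatrix S R).rank :=
  card_le_two_mul_rank_laMatrix_of_witnesses S R hR hScl hanti fun _ _ =>
    ⟨∅, h0, ∅, h0, empty_subset _, empty_subset _, hR.refl _, hR.refl _⟩

end TwistedAD

end Summit.CriticalPhenomena.PercolationContinuityZ3.Theorems
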